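import Summits.ABC.IUTFork.Joshi.AdelicAnsatzDerived

/-!
# [J-III] Thm. 4.2.2.1 (3): a model separating the LITERAL and the DIAGONAL reading (READING-QUESTION evidence)

Block E, seat abc-iut-E-t7, slot T-07 (cell abc-iut, rung LADDER-ABC:A2.E). TAKES NO SIDE on [IUTchIII] Cor. 3.12, on
Joshi's claims, or on Mochizuki's reports on them; typed ≠ proved. This file is EVIDENCE for the READING QUESTION
recorded in `Joshi/AdelicAnsatz.lean` (module docstring) and raised on STATUS for the double-read by E-ref / E-cx
(E-PLAN R8: no single-point elimination); it adjudicates nothing and is «J-FALSE-IN-A-MODEL (literal reading)» data in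
the sense of E-PLAN R13, not a COUNTERMODEL line.

THE QUESTION. [J-III] (K. Joshi, arXiv:2401.13508v4) Thm. 4.2.2.1 (3), p.33 l.1–2: «Hence `Σ̃_{L′}` is also stable under
the natural action of `(L′)*` on `𝒴_{L′}` constructed in [Joshi, 2023a, Theorem 4.2.3]». Def. 4.2.1 (3), p.31 l.28–35,
defines the `(L′)*`-action on `𝒴^{ℓ*}_{L′}` WITH A TWIST: `x · z = (x·y₁, x^{2²}·y₂, …, x^{ℓ*²}·y_{ℓ*})`. The typing
file records both readings: `AnsatzLStarStable` (LITERAL: the twisted action of Def. 4.2.1 (3)) and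
`AnsatzLStarStableDiag` (DIAGONAL: the action induced factorwise from [J-2½] Thm. 4.2.3 (3)), and derives only the
latter (`ansatzLStarStableDiag_of`, from [J-2½] Thm. 4.2.3 (4) «at non-archimedean `v` the `L*`-action is through powers
of the Frobenius» and [J-2p] Prop. 6.6.1).

THE MODEL `readingModel` (one place, OFF `V^{odd,ss}`, so that (4.2.3) is the pure diagonal condition
`z_w = (y_w, …, y_w)`; `ℓ* = 2`): the factor `|Y|` is `ℤ` with Frobenius = translation by `1` (a FREE action, as
`ϕ^ℤ` acts freely on the closed classical points of a Fargues–Fontaine curve, `X = Y/ϕ^ℤ`), and `x ∈ L′* := ℤ` acts by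
translation by `x`, i.e. THROUGH THE `x`-th POWER OF FROBENIUS — the situation of [J-2½] Thm. 4.2.3 (4) at a good
non-archimedean place; `xⁿ` is `n·x`. All four typed INPUTS of `Joshi/AdelicAnsatz.lean` §3 hold in the model
(`readingModel_inputs`), hence so do the derived claims (1), (2), (3)-diagonal, (4), (5); but the LITERAL (3) FAILS
(`not_ansatzLStarStable_readingModel`): the diagonal point `(0, 0)` goes to `(0 + 1·1, 0 + 4·1) = (1, 4)`, which is not
diagonal. In words: wherever some `x ∈ L′*` acts non-trivially at a place off `V^{odd,ss}` (e.g. a uniformiser at a good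
non-archimedean place acting by Frobenius), the twist `x^{j²}` of Def. 4.2.1 (3) destroys the diagonal condition of
(4.2.3). The downstream uses of §4.2 in [J-III] (§6.3 p.44 l.32, §6.4.1 p.45 l.43, §8.10 p.90 l.24, §9.4.8 p.105 l.68)
cite only membership in `Σ̃_{L′}` and the valuation scaling (4), never (3). Located, not adjudicated.
-/

namespace Summit.ABC.IUTFork.Joshi

namespace AdelicCurveDatum

/-- Iterating a translation: `(· + c)^[n] y = y + n·c`. [folklore] -/
theorem iterate_add_const (c : ℤ) (n : ℕ) (y : ℤ) : (fun t : ℤ => t + c)^[n] y = y + n * c := by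
  induction n generalizing y with
  | zero => simp
  | succ n ih => rw [Function.iterate_succ_apply, ih]; push_cast; ring

/-- **The separating model** (see the module docstring): one place off `V^{odd,ss}`, `|Y| = ℤ`, Frobenius = `+1`
(free), `L′* = ℤ` acting by translation (= through Frobenius powers), `xⁿ := n·x`, `ℓ* = 2`, trivial Galois data,
constant residue valuations, primitive ansatz = everything. No mathematical content beyond the separation. -/
def readingModel : AdelicCurveDatum where
  V := Unit
  oddss := ∅
  P := Unit
  pOf _ := ()
  Y _ := ℤ
  Y0 _ := Unit
  forget _ _ := ()
  lstar := 2
  one_le_lstar := by decide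
  G _ := Unit
  gact _ _ y := y
  G0 _ := Unit
  g0act _ _ _ := ()
  res _ _ := ()
  forget_gal _ _ _ := rfl
  frob _ := Equiv.addRight (1 : ℤ)
  frob0 _ := Equiv.refl Unit
  forget_frob _ _ := rfl
  Lstar := ℤ
  lpow x n := (n : ℤ) * x
  lact x _ y := y + x
  lact_lpow x n _ y := by
    show y + (n : ℤ) * x = (fun t : ℤ => t + x)^[n] y
    rw [iterate_add_const]
  T _ := Unit
  absK _ _ _ := 1
  absK0 _ _ _ := 1
  forget_abs _ _ := rfl
  primAnsatz _ := Set.univ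

/-- In the model, `x ∈ L′*` acts on the factor through the `x`-th power of Frobenius for natural `x`
(`(+1)^[x] = (+x)`): the [J-2½] Thm. 4.2.3 (4) situation, here at the (good) place of the model. [folklore] -/
theorem readingModel_lact_eq_frob_iterate (x : ℕ) (y : ℤ) :
    readingModel.lact (x : ℤ) () y = (readingModel.frob ())^[x] y := by
  show y + (x : ℤ) = (fun t : ℤ => t + 1)^[x] y
  rw [iterate_add_const, mul_one]

/-- All four typed INPUTS of `Joshi/AdelicAnsatz.lean` §3 hold in the model (the last two trivially: the model has
no place in `V^{odd,ss}` and constant valuations). [folklore] -/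
theorem readingModel_inputs :
    readingModel.PrimAnsatzGaloisStable ∧ readingModel.PrimAnsatzFrobeniusInvariant ∧
      readingModel.PrimAnsatzScaling ∧ readingModel.LStarThroughFrobenius :=
  ⟨fun _ _ _ _ => Set.mem_univ _, fun _ _ => ⟨fun _ => Set.mem_univ _, fun _ => Set.mem_univ _⟩,
    fun _ _ _ _ _ => (one_pow _).symm, fun w hw => (Set.notMem_empty w hw).elim⟩

/-- The diagonal point `(0, 0)` lies in the model's Adelic Ansatz. [folklore] -/
theorem readingModel_zero_mem : (fun _ _ => (0 : ℤ)) ∈ readingModel.adelicAnsatz :=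
  ⟨fun _ _ _ => rfl, fun w hw => (Set.notMem_empty w hw).elim⟩

/-- **Thm. 4.2.2.1 (3) in the DIAGONAL reading holds in the model** (by the general derivation
`ansatzLStarStableDiag_of` from the inputs). [folklore] -/
theorem ansatzLStarStableDiag_readingModel : readingModel.AnsatzLStarStableDiag :=
  readingModel.ansatzLStarStableDiag_of readingModel_inputs.2.2.2 readingModel_inputs.2.1

/-- **Thm. 4.2.2.1 (3) in the LITERAL reading (the twisted action of Def. 4.2.1 (3)) FAILS in the model**: `x = 1`
sends the Ansatz point `(0, 0)` to `(0 + 1²·1, 0 + 2²·1) = (1, 4)`, which violates the diagonal condition (4.2.3) at the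
(good) place. READING-QUESTION evidence for E-ref / E-cx; located, not adjudicated. [folklore] -/
theorem not_ansatzLStarStable_readingModel : ¬ readingModel.AnsatzLStarStable := by
  intro h
  have hmem := h (1 : ℤ) _ readingModel_zero_mem
  have hdiag := hmem.1 () (Set.notMem_empty ()) ⟨1, by decide⟩
  -- the entry at printed index 2 is `0 + (2²·1)`, the entry at printed index 1 is `0 + (1²·1)`
  change (0 : ℤ) + ((((1 : ℕ) + 1) ^ 2 : ℕ) : ℤ) * 1 = (0 : ℤ) + ((((0 : ℕ) + 1) ^ 2 : ℕ) : ℤ) * 1 at hdiag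
  norm_num at hdiag

/-- Summary: the model satisfies every typed input and the diagonal reading of (3), and refutes the literal reading —
so the two readings of Thm. 4.2.2.1 (3) are NOT equivalent over the typed signature. [folklore] -/
theorem readings_of_thm4221_3_differ :
    ∃ D : AdelicCurveDatum, D.PrimAnsatzGaloisStable ∧ D.PrimAnsatzFrobeniusInvariant ∧ D.PrimAnsatzScaling ∧
      D.LStarThroughFrobenius ∧ D.AnsatzLStarStableDiag ∧ ¬ D.AnsatzLStarStable :=
  ⟨readingModel, readingModel_inputs.1, readingModel_inputs.2.1, readingModel_inputs.2.2.1,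
    readingModel_inputs.2.2.2, ansatzLStarStableDiag_readingModel, not_ansatzLStarStable_readingModel⟩

end AdelicCurveDatum

end Summit.ABC.IUTFork.Joshi
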